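import Literature.NumberTheory.EllipticCurves.KubertTate1718SqrtNegTwoDescent
import Literature.NumberTheory.EllipticCurves.KubertTateFiveEisensteinTwistMinimalModel
import Literature.NumberTheory.EllipticCurves.LocalReductionKrausMinimality
import Literature.NumberTheory.QuadraticFields.DiscriminantOfSqrt
import HarnessLib

/-!
# The quadratic twist `E_{17/18}^{(−8)}/ℚ`: RANK `2` and `t₅ = 0`, by the `5`-descent over `ℚ(√−2)` — a rank-two curve
# without rational `5`-torsion at which `5` is a good ordinary NON-anomalous prime (the third quadratic field of the twist door)

PROOF-ONLY file (theorems only, no definition, no named fact, no `sorry`), topic `NumberTheory/EllipticCurves`; the `ℚ(√−2)`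
twin of the tree's `KubertTate1314EisensteinTwist` §1 / `KubertTateFiveEisensteinTwist` §2.

* §1 CLASS-WIDE over `ℚ(√−2)`: `discr_sqrtNegTwo` (`d_K = −8` for `[K : ℚ] = 2`, `θ² = −2`; tree
  `Quadratic.discr_eq_four_mul_of_sq_eq_intCast_of_neg`), **`mordellWeilRank_base_eq_add_sqrtNegTwo`**
  (`rank E_{m,n}(K) = rank E_{m,n}(ℚ) + rank E_{m,n}^{(−8)}(ℚ)`, tree `mordellWeilRank_baseChange_quadratic_holds`),
  **`shaCorank_twist_eq_zero_of_base_sqrtNegTwo`** (`t₅(E_{m,n} ⊗ K) = 0 ⟹ t₅(E_{m,n}^{(−8)}/ℚ) = 0 ∧ t₅(E_{m,n}/ℚ) = 0`: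
  `corank Sel₅∞(E_K) = corank Sel₅∞(E) + corank Sel₅∞(E^{(−8)})`, tree `selmerCorank_baseChange_quadratic_holds`, with Greenberg's
  `corank Sel = rank + t`).
* §2 THE INSTANCE `(m, n) = (17, 18)` (tree `KubertTate1718SqrtNegTwoDescent`: `rank E(K) = 4`, `t₅(E ⊗ K) = 0` for EVERY such `K`;
  instantiated at Mathlib's `QuadraticAlgebra ℚ (-2) 0 = ℚ[ω]/(ω² + 2)` inside the proofs, so no model of `ℚ(√−2)` is defined):
  **`mordellWeilRank_twist_eq_two`** — `rank E_{17/18}^{(−8)}(ℚ) = 4 − 2 = 2`; **`shaCorank_five_twist_eq_zero`** —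
  `t₅(E_{17/18}^{(−8)}/ℚ) = 0`; `twist_17_18` (both, with the `ℚ`-side `rank 2`, `t₅ = 0` of `KubertTate1718ShaFive`);
  `twist_eq` — `E_{17/18}^{(−8)} = [0, 2446, 0, −176256, −3883272192]`.
* §3 THE MODEL `W₈ = [0, 2446, 0, −176256, −3883272192]` IS GLOBALLY MINIMAL (`isGloballyMinimal_model`: `Δ = −2²³·3¹⁰·17⁵·19·179`,
  `c₄ = 2⁶·1627921`, `c₆ = 2⁹·4481239033`; Kraus at `2`: `2²⁴ ∤ Δ`, `2⁸ ∤ c₄`, `2⁸ ∤ c₆ + 2⁶`; no other prime to the twelfth power), has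
  reducible `W₈[5]` (`red_five_model`, twist of the rational `5`-isogeny) and `rank 2`, `t₅ = 0` (`rank_two_door_at_five_model`).

Why (stmt-BirchSwinnertonDyer-22356, «T = FiniteShaComponentTransfer»; BSD and T are NOT proved by this): `E_{17/18}^{(−8)}` has no
rational `5`-torsion (the twist kills `T`), `5` is good (`5 ∤ Δ(E)·8`) and INERT in `ℚ(√−2)`, so `a₅(E^{(−8)}) = (−8|5)·a₅(E) = −a₅(E) = −1`:
a rank-TWO door at a NON-anomalous good ordinary prime — the shape of the Castella–Grossi–Lee–Skinner `p`-converse, in the rank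
where no converse theorem is in print; the third quadratic field (after the anomalous Gaussian doors and the Eisenstein doors of
this seat's g20–g23) over which the door at `5` opens by descent alone.

## References

* [SilvermanAEC2009] J. H. Silverman, *AEC*, 2nd ed., Thm. X.4.2, Exercise 10.16, X.§2.
* [Dokchitser2013ParityNotes] T. Dokchitser, *Notes on the parity conjecture* (2013), §4 (Selmer groups under quadratic base change).
* [Marcus2018] D. A. Marcus, *Number Fields*, 2nd ed., Ch. 2 Thm. 1 (`d_{ℚ(√−2)} = −8`).
-/

noncomputable section

open scoped Classical
open WeierstrassCurve Literature.NumberTheory.EllipticCurves Literature.NumberTheory.EllipticCurves.KubertTateVelu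
  Literature.NumberTheory.EllipticCurves.KubertTateGaussianTwist Literature.NumberTheory.QuadraticFields
open Literature.NumberTheory.EllipticCurves.Rank1Residual.X11RankOneCertificates (discOf c4Of c6Of)

namespace Literature.NumberTheory.EllipticCurves

namespace KubertTateSqrtNegTwoTwist

/-! ## §1 Class-wide: the Mordell–Weil rank and `t₅` over `ℚ(√−2)` split along the twist by `−8` -/

section General

variable {K : Type} [Field K] [NumberField K] {θ : K}
variable (m n : ℤ) [hE : (kubertTateFive (m : ℚ) (n : ℚ)).IsElliptic]

omit hE in
/-- **`d_K = −8`** for a quadratic field `K ∋ θ`, `θ² = −2` (`−2 ≡ 2 (mod 4)` squarefree, `d_K = 4·(−2)`).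
[cite: Marcus2018, Ch. 2 Thm. 1] -/
theorem discr_sqrtNegTwo (hK : SqrtNegTwo.FieldData θ) : NumberField.discr K = -8 := by
  have hsq : θ ^ 2 = ((-2 : ℤ) : K) := by rw [hK.sq_eq]; norm_num
  have h := (Quadratic.discr_eq_four_mul_of_sq_eq_intCast_of_neg hK.finrank_eq hsq (by norm_num) (by decide)
    (by rw [← Int.squarefree_natAbs]; exact Nat.prime_two.squarefree)).1
  rw [h]; norm_num

/-- Transport of the Mordell–Weil rank along an equality of curves. [folklore] -/
private theorem mordellWeilRank_congr {F : Type} [Field F] [NumberField F] {V V' : WeierstrassCurve F}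
    [V.IsElliptic] [V'.IsElliptic] (e : V = V') : V.mordellWeilRank = V'.mordellWeilRank := by
  subst e; rfl

/-- Transport of `t_p` along an equality of curves. [folklore] -/
private theorem shaCorank_congr {F : Type} [Field F] [NumberField F] {V V' : WeierstrassCurve F}
    [V.IsElliptic] [V'.IsElliptic] (e : V = V') (p : ℕ) [Fact p.Prime] : V.shaCorank p = V'.shaCorank p := by
  subst e; rfl

/-- **`rank E(K) = rank E(ℚ) + rank E^{(−8)}(ℚ)`** for `E = E_{m,n}` and `K = ℚ(√−2)` (tree `mordellWeilRank_baseChange_quadratic_holds`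
at `d_K = −8`, transported to the model `E_{m,n}/K`). [cite: SilvermanAEC2009, Exercise 10.16] -/
theorem mordellWeilRank_base_eq_add_sqrtNegTwo (hK : SqrtNegTwo.FieldData θ)
    [((kubertTateFive (m : ℚ) (n : ℚ)).quadraticTwist (-8)).IsElliptic] :
    haveI := isElliptic_base (K := K) m n
    (kubertTateFive (m : K) (n : K)).mordellWeilRank =
      (kubertTateFive (m : ℚ) (n : ℚ)).mordellWeilRank + ((kubertTateFive (m : ℚ) (n : ℚ)).quadraticTwist (-8)).mordellWeilRank := by
  haveI := isElliptic_base (K := K) m n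
  haveI : ((kubertTateFive (m : ℚ) (n : ℚ)).baseChange K).IsElliptic := by
    rw [KubertTateMuDescentNF.baseChange_eq (K := ℚ) m n K]; infer_instance
  have hd : ((NumberField.discr K : ℤ) : ℚ) ≠ 0 := by exact_mod_cast NumberField.discr_ne_zero K
  haveI : ((kubertTateFive (m : ℚ) (n : ℚ)).quadraticTwist (NumberField.discr K : ℚ)).IsElliptic :=
    isElliptic_quadraticTwist _ hd
  have hR := mordellWeilRank_baseChange_quadratic_holds (kubertTateFive (m : ℚ) (n : ℚ)) K hK.finrank_eq
  rw [mordellWeilRank_congr (KubertTateMuDescentNF.baseChange_eq (K := ℚ) m n K)] at hR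
  have h8 : ((NumberField.discr K : ℤ) : ℚ) = -8 := by rw [discr_sqrtNegTwo hK]; norm_num
  rw [h8] at hR
  exact hR

/-- **`t₅(E ⊗ K) = 0 ⟹ t₅(E^{(−8)}/ℚ) = 0`, `t₅(E/ℚ) = 0` and `rank E^{(−8)}(ℚ) = rank E(K) − rank E(ℚ)`** for `E = E_{m,n}`, `K = ℚ(√−2)`:
`corank Sel₅∞(E_K) = corank Sel₅∞(E) + corank Sel₅∞(E^{(−8)})` (tree `selmerCorank_baseChange_quadratic_holds`), `rank E_K = rank E + rank E^{(−8)}`,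
and Greenberg's `corank Sel = rank + t` on all three curves. [cite: Dokchitser2013ParityNotes, §4] [cite: SilvermanAEC2009, Thm. X.4.2] -/
theorem shaCorank_twist_eq_zero_of_base_sqrtNegTwo (hK : SqrtNegTwo.FieldData θ)
    [((kubertTateFive (m : ℚ) (n : ℚ)).quadraticTwist (-8)).IsElliptic]
    (h0 : haveI := isElliptic_base (K := K) m n; (kubertTateFive (m : K) (n : K)).shaCorank 5 = 0) :
    ((kubertTateFive (m : ℚ) (n : ℚ)).quadraticTwist (-8)).shaCorank 5 = 0 ∧ (kubertTateFive (m : ℚ) (n : ℚ)).shaCorank 5 = 0 := by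
  haveI : Fact (Nat.Prime 5) := ⟨Nat.prime_five⟩
  haveI := isElliptic_base (K := K) m n
  set W := kubertTateFive (m : ℚ) (n : ℚ) with hW
  haveI hbc : (W.baseChange K).IsElliptic := by
    rw [hW, KubertTateMuDescentNF.baseChange_eq (K := ℚ) m n K]; infer_instance
  have hd : ((NumberField.discr K : ℤ) : ℚ) ≠ 0 := by exact_mod_cast NumberField.discr_ne_zero K
  haveI : (W.quadraticTwist (NumberField.discr K : ℚ)).IsElliptic := isElliptic_quadraticTwist _ hd
  have hS := selmerCorank_baseChange_quadratic_holds W K hK.finrank_eq 5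
  have hR := mordellWeilRank_baseChange_quadratic_holds W K hK.finrank_eq
  have hKid := (W.baseChange K).selmerCorank_eq_mordellWeilRank_add_holds 5
  have hQ := W.selmerCorank_eq_mordellWeilRank_add_holds 5
  have hT := (W.quadraticTwist (NumberField.discr K : ℚ)).selmerCorank_eq_mordellWeilRank_add_holds 5
  have h0' : (W.baseChange K).shaCorank 5 = 0 := by
    rw [shaCorank_congr (KubertTateMuDescentNF.baseChange_eq (K := ℚ) m n K) 5]
    exact h0
  have h8 : ((NumberField.discr K : ℤ) : ℚ) = -8 := by rw [discr_sqrtNegTwo hK]; norm_num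
  rw [h8] at hS hR hT
  omega

end General

/-! ## §2 The instance `E_{17/18}^{(−8)}`: rank `2` and `t₅ = 0` from the descent over `ℚ(√−2)` -/

/-- **`E_{17/18}^{(−8)} = [0, 2446, 0, −176256, −3883272192]`** (`b₂ = -1223`, `b₄ = -5508`, `b₆ = 30338064`; twist by `d = −8`).
[cite: SilvermanAEC2009, X.§2] -/
theorem twist_eq : (kubertTateFive (((17 : ℤ) : ℚ)) (((18 : ℤ) : ℚ))).quadraticTwist (-8) =
    (⟨0, 2446, 0, -176256, -3883272192⟩ : WeierstrassCurve ℚ) := by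
  rw [KubertTate1718Descent.curve_eq]
  ext <;> simp [quadraticTwist, WeierstrassCurve.b₂, WeierstrassCurve.b₄, WeierstrassCurve.b₆] <;> norm_num

/-- The twist by `−8` is elliptic. [cite: SilvermanAEC2009, X.§2] -/
theorem isElliptic_twist :
    haveI := KubertTate1718Descent.isElliptic
    ((kubertTateFive (((17 : ℤ) : ℚ)) (((18 : ℤ) : ℚ))).quadraticTwist (-8)).IsElliptic := by
  haveI := KubertTate1718Descent.isElliptic
  exact isElliptic_quadraticTwist _ (by norm_num)

/-- **A model of `ℚ(√−2)` exists** (no definition is introduced): Mathlib's `QuadraticAlgebra ℚ (-2) 0 = ℚ[ω]/(ω² + 2)` is a number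
field of degree `2` in which `ω² = −2`. [cite: Marcus2018, Ch. 2 Thm. 1] -/
theorem exists_sqrtNegTwo_field :
    ∃ (K : Type) (_ : Field K) (_ : NumberField K) (θ : K), SqrtNegTwo.FieldData θ := by
  haveI hf : Fact (∀ r : ℚ, r ^ 2 ≠ (-2 : ℚ) + 0 * r) := ⟨fun r h ↦ by nlinarith [sq_nonneg r]⟩
  haveI : NumberField (QuadraticAlgebra ℚ (-2) 0) := NumberField.mk
  refine ⟨QuadraticAlgebra ℚ (-2) 0, inferInstance, inferInstance, QuadraticAlgebra.omega, ⟨QuadraticAlgebra.finrank_eq_two _ _, ?_⟩⟩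
  rw [sq, QuadraticAlgebra.omega_mul_omega_eq_mk]
  ext <;> simp [QuadraticAlgebra.re_ofNat, QuadraticAlgebra.im_ofNat]

/-- **`rank E_{17/18}^{(−8)}(ℚ) = 2`, unconditionally**: `rank E(K) = rank E(ℚ) + rank E^{(−8)}(ℚ)` at `K = ℚ(√−2)` with `4 = 2 + rank E^{(−8)}(ℚ)`
(`KubertTate1718SqrtNegTwoDescent.mordellWeilRank_eq_four`, `KubertTate1718Descent.mordellWeilRank_eq`). [cite: SilvermanAEC2009, Exercise 10.16] -/
theorem mordellWeilRank_twist_eq_two :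
    haveI := KubertTate1718Descent.isElliptic
    haveI := isElliptic_twist
    ((kubertTateFive (((17 : ℤ) : ℚ)) (((18 : ℤ) : ℚ))).quadraticTwist (-8)).mordellWeilRank = 2 := by
  haveI := KubertTate1718Descent.isElliptic
  haveI := isElliptic_twist
  obtain ⟨K, _, _, θ, hK⟩ := exists_sqrtNegTwo_field
  have hR := mordellWeilRank_base_eq_add_sqrtNegTwo (K := K) 17 18 hK
  have h4 := KubertTate1718SqrtNegTwoDescent.mordellWeilRank_eq_four hK
  have h2 := KubertTate1718Descent.mordellWeilRank_eq
  simp only [Int.cast_ofNat] at hR h4 h2 ⊢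
  omega

/-- **`t₅(E_{17/18}^{(−8)}/ℚ) = 0`, unconditionally** — the door at `5` on a RANK-`2` twist WITHOUT a rational `5`-torsion point, at a
NON-anomalous good ordinary prime (`5` inert in `ℚ(√−2)`), by descent alone (`t₅(E ⊗ ℚ(√−2)) = 0`,
`KubertTate1718SqrtNegTwoDescent.shaCorank_five_eq_zero`). [cite: Dokchitser2013ParityNotes, §4] [cite: SilvermanAEC2009, Thm. X.4.2] -/
theorem shaCorank_five_twist_eq_zero :
    haveI := KubertTate1718Descent.isElliptic
    haveI := isElliptic_twist
    ((kubertTateFive (((17 : ℤ) : ℚ)) (((18 : ℤ) : ℚ))).quadraticTwist (-8)).shaCorank 5 = 0 := by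
  haveI := KubertTate1718Descent.isElliptic
  haveI := isElliptic_twist
  obtain ⟨K, _, _, θ, hK⟩ := exists_sqrtNegTwo_field
  have h := shaCorank_twist_eq_zero_of_base_sqrtNegTwo (K := K) 17 18 hK
    (by simpa using KubertTate1718SqrtNegTwoDescent.shaCorank_five_eq_zero hK)
  simpa using h.1

/-- **Both components at once**: `rank E_{17/18}^{(−8)}(ℚ) = 2`, `t₅(E_{17/18}^{(−8)}/ℚ) = 0`, together with `rank E_{17/18}(ℚ) = 2`,
`t₅(E_{17/18}/ℚ) = 0` (tree) — the cross-field picture `rank E(ℚ(√−2)) = 2 + 2`, `t₅(E ⊗ ℚ(√−2)) = 0 + 0`.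
[cite: SilvermanAEC2009, Thm. X.4.2 and Exercise 10.16] -/
theorem twist_17_18 :
    haveI := KubertTate1718Descent.isElliptic
    haveI := isElliptic_twist
    ((kubertTateFive (((17 : ℤ) : ℚ)) (((18 : ℤ) : ℚ))).quadraticTwist (-8)).mordellWeilRank = 2 ∧
      ((kubertTateFive (((17 : ℤ) : ℚ)) (((18 : ℤ) : ℚ))).quadraticTwist (-8)).shaCorank 5 = 0 ∧
      (kubertTateFive (((17 : ℤ) : ℚ)) (((18 : ℤ) : ℚ))).mordellWeilRank = 2 ∧
      (kubertTateFive (((17 : ℤ) : ℚ)) (((18 : ℤ) : ℚ))).shaCorank 5 = 0 :=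
  ⟨mordellWeilRank_twist_eq_two, shaCorank_five_twist_eq_zero, KubertTate1718Descent.mordellWeilRank_eq,
    KubertTate1718Descent.shaCorank_five_eq_zero⟩

/-- **The twist as the explicit curve `[0, 2446, 0, −176256, −3883272192]`: rank `2` and `t₅ = 0`.** [cite: SilvermanAEC2009, Thm. X.4.2] -/
theorem rank_two_door_at_five_model :
    haveI : (⟨0, 2446, 0, -176256, -3883272192⟩ : WeierstrassCurve ℚ).IsElliptic := by
      haveI := KubertTate1718Descent.isElliptic; rw [← twist_eq]; exact isElliptic_twist
    (⟨0, 2446, 0, -176256, -3883272192⟩ : WeierstrassCurve ℚ).mordellWeilRank = 2 ∧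
      (⟨0, 2446, 0, -176256, -3883272192⟩ : WeierstrassCurve ℚ).shaCorank 5 = 0 := by
  haveI := KubertTate1718Descent.isElliptic
  haveI := isElliptic_twist
  haveI : (⟨0, 2446, 0, -176256, -3883272192⟩ : WeierstrassCurve ℚ).IsElliptic := by
    rw [← twist_eq]; exact isElliptic_twist
  haveI : Fact (Nat.Prime 5) := ⟨Nat.prime_five⟩
  exact ⟨by rw [← mordellWeilRank_congr twist_eq]; exact mordellWeilRank_twist_eq_two,
    by rw [← shaCorank_congr twist_eq 5]; exact shaCorank_five_twist_eq_zero⟩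

/-! ## §3 The model `W₈ = [0, 2446, 0, −176256, −3883272192]`: globally minimal, `W₈[5]` reducible -/

/-- The integer-cast form of the model equals the rational-numeral form. [folklore] -/
private theorem model_cast_eq :
    (⟨((0 : ℤ) : ℚ), ((2446 : ℤ) : ℚ), ((0 : ℤ) : ℚ), ((-176256 : ℤ) : ℚ), ((-3883272192 : ℤ) : ℚ)⟩ : WeierstrassCurve ℚ) =
      ⟨0, 2446, 0, -176256, -3883272192⟩ := by
  ext <;> norm_num

/-- The cast model is elliptic. [cite: SilvermanAEC2009, X.§2] -/
theorem isElliptic_model :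
    (⟨((0 : ℤ) : ℚ), ((2446 : ℤ) : ℚ), ((0 : ℤ) : ℚ), ((-176256 : ℤ) : ℚ), ((-3883272192 : ℤ) : ℚ)⟩ : WeierstrassCurve ℚ).IsElliptic := by
  haveI := KubertTate1718Descent.isElliptic
  rw [model_cast_eq, ← twist_eq]; exact isElliptic_twist

/-- `Δ`, `c₄`, `c₆` of the integer model (kernel evaluation): `Δ(W₈) = −2391958752432010297344 = −2²³·3¹⁰·17⁵·19·179`,
`c₄ = 104186944 = 2⁶·1627921`, `c₆ = 2294394384896 = 2⁹·4481239033`. [folklore] -/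
private theorem invariants_model :
    discOf [0, 2446, 0, -176256, -3883272192] = -2391958752432010297344 ∧
      c4Of [0, 2446, 0, -176256, -3883272192] = 104186944 ∧ c6Of [0, 2446, 0, -176256, -3883272192] = 2294394384896 := by
  refine ⟨?_, ?_, ?_⟩ <;> decide

/-- **`W₈` is globally minimal**: at `2` by Kraus (`v₂(Δ) = 23 < 24`, `v₂(c₄) = 6 < 8`, `v₂(c₆ + 2⁶) = 6 < 8`: additive reduction of the
`−8`-twist at `2`, the equation already minimal), and no odd prime divides `Δ(W₈) = −2²³·3¹⁰·17⁵·19·179` to the twelfth power.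
[cite: Kraus1989, Prop. 2] [cite: SilvermanAEC2009, VII.1 Remark 1.1] -/
theorem isGloballyMinimal_model :
    (⟨((0 : ℤ) : ℚ), ((2446 : ℤ) : ℚ), ((0 : ℤ) : ℚ), ((-176256 : ℤ) : ℚ), ((-3883272192 : ℤ) : ℚ)⟩ : WeierstrassCurve ℚ).IsGloballyMinimal := by
  obtain ⟨hD, hc4, hc6⟩ := invariants_model
  refine WeierstrassCurve.isGloballyMinimal_of_int_kraus 0 2446 0 (-176256) (-3883272192) fun q hq ↦ ?_
  by_cases hq2 : q = 2
  · subst hq2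
    refine Or.inr (Or.inl ⟨rfl, ?_, ?_, ?_⟩)
    · rw [hD]; norm_num
    · rw [hc4]; norm_num
    · rw [hc6]; norm_num
  · refine Or.inl fun h ↦ ?_
    obtain ⟨h12, -⟩ := h
    rw [hD] at h12
    have hq1 : (q : ℤ) ∣ 2391958752432010297344 := Int.dvd_neg.mp (dvd_trans (dvd_pow_self _ (by norm_num)) h12)
    have hdvdN : q ∣ 2 ^ 23 * 3 ^ 10 * 17 ^ 5 * 19 * 179 := by
      have e : ((2 ^ 23 * 3 ^ 10 * 17 ^ 5 * 19 * 179 : ℕ) : ℤ) = 2391958752432010297344 := by norm_num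
      exact Int.natCast_dvd_natCast.mp (e ▸ hq1)
    have hpi := Nat.Prime.prime hq
    rcases hpi.dvd_or_dvd hdvdN with h | h
    · rcases hpi.dvd_or_dvd h with h | h
      · rcases hpi.dvd_or_dvd h with h | h
        · rcases hpi.dvd_or_dvd h with h | h
          · exact hq2 ((Nat.prime_dvd_prime_iff_eq hq Nat.prime_two).mp (hpi.dvd_of_dvd_pow h))
          · have := (Nat.prime_dvd_prime_iff_eq hq Nat.prime_three).mp (hpi.dvd_of_dvd_pow h)
            subst this; revert h12; norm_num
        · have := (Nat.prime_dvd_prime_iff_eq hq (by norm_num : Nat.Prime 17)).mp (hpi.dvd_of_dvd_pow h)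
          subst this; revert h12; norm_num
      · have := (Nat.prime_dvd_prime_iff_eq hq (by norm_num : Nat.Prime 19)).mp h
        subst this; revert h12; norm_num
    · have := (Nat.prime_dvd_prime_iff_eq hq (by norm_num : Nat.Prime 179)).mp h
      subst this; revert h12; norm_num

/-- **`W₈[5]` is reducible** (quadratic twist of `E_{17/18}`, whose rational point `(0,0)` of order `5` spans a `Γ_ℚ`-stable line; tree
`Rank1Residual.not_hasIrreducibleModPGaloisRep_twist`). [cite: SilvermanAEC2009, X.5 Cor. 5.4] -/
theorem red_five_model :
    haveI := isElliptic_model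
    haveI : Fact (Nat.Prime 5) := ⟨Nat.prime_five⟩
    ¬ (⟨((0 : ℤ) : ℚ), ((2446 : ℤ) : ℚ), ((0 : ℤ) : ℚ), ((-176256 : ℤ) : ℚ), ((-3883272192 : ℤ) : ℚ)⟩ :
        WeierstrassCurve ℚ).HasIrreducibleModPGaloisRep 5 := by
  haveI := KubertTate1718Descent.isElliptic
  haveI := isElliptic_model
  haveI : Fact (Nat.Prime 5) := ⟨Nat.prime_five⟩
  exact Rank1Residual.not_hasIrreducibleModPGaloisRep_twist (KubertTateEisensteinTwist.red_five 17 18) (d := -8) (by norm_num)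
    _ (1 : VariableChange ℚ) (by rw [one_smul, model_cast_eq, twist_eq])

/-- **`rank W₈(ℚ) = 2` and `t₅(W₈) = 0` on the cast model.** [cite: SilvermanAEC2009, Thm. X.4.2] -/
theorem door_model_cast :
    haveI := isElliptic_model
    (⟨((0 : ℤ) : ℚ), ((2446 : ℤ) : ℚ), ((0 : ℤ) : ℚ), ((-176256 : ℤ) : ℚ), ((-3883272192 : ℤ) : ℚ)⟩ : WeierstrassCurve ℚ).mordellWeilRank = 2 ∧
      (⟨((0 : ℤ) : ℚ), ((2446 : ℤ) : ℚ), ((0 : ℤ) : ℚ), ((-176256 : ℤ) : ℚ), ((-3883272192 : ℤ) : ℚ)⟩ : WeierstrassCurve ℚ).shaCorank 5 = 0 := by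
  haveI := KubertTate1718Descent.isElliptic
  haveI := isElliptic_twist
  haveI := isElliptic_model
  haveI : Fact (Nat.Prime 5) := ⟨Nat.prime_five⟩
  have e : (kubertTateFive (((17 : ℤ) : ℚ)) (((18 : ℤ) : ℚ))).quadraticTwist (-8) =
      ⟨((0 : ℤ) : ℚ), ((2446 : ℤ) : ℚ), ((0 : ℤ) : ℚ), ((-176256 : ℤ) : ℚ), ((-3883272192 : ℤ) : ℚ)⟩ := by
    rw [twist_eq, model_cast_eq]
  exact ⟨by rw [← mordellWeilRank_congr e]; exact mordellWeilRank_twist_eq_two,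
    by rw [← shaCorank_congr e 5]; exact shaCorank_five_twist_eq_zero⟩

end KubertTateSqrtNegTwoTwist

end Literature.NumberTheory.EllipticCurves

end
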